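import Literature.Geometry.Lorentzian.InitialDataHomothety
import Literature.Geometry.Lorentzian.InitialDataLocality
import Literature.Geometry.Lorentzian.HintzGluedEMRIData
import Literature.Geometry.Lorentzian.IsometryProofs
import Literature.Geometry.Lorentzian.LeviCivitaProofs
import Literature.Geometry.Riemannian.IsometryGeodesicCompleteness

/-!
# Physical dilation of initial data on `ℝ³`

For an initial data set `C = (h, k)` on `E3 = ℝ³` and `l > 0`, the dilated data `C.dilate l`
have `h'(y)(v, w) = h(y/l)(v, w)`, `k'(y)(v, w) = l⁻¹ k(y/l)(v, w)`: the pullback along the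
diffeomorphism `y ↦ y/l` (`InitialDataSet.comap`, `InitialDataPullback.lean`) followed by the
homothety `(h, k) ↦ (l² h, l k)` (`InitialDataSet.homothety`, `InitialDataHomothety.lean`). This
is the datum induced on the SAME slice, re-coordinatised by `y ↦ l y`, by the homothetic
development `l² g` — the scaling used to place small or large bodies in gluing constructions
(Bartnik–Isenberg 2004, §2; Corvino–Schoen; Hintz 2022).

* `isComplete_homothety_iff` — completeness is invariant under homotheties (same Levi-Civita
  connection, `leviCivita_homothety`), for data on any manifold;
* `InitialDataSet.dilate C l hl`, `coordH_dilate`, `coordK_dilate`, `dilate_h_inner`, `dilate_k` —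
  the dilated data and their components (`coordH`/`coordK` of `HintzGluedEMRIData.lean`);
* `isVacuumConstraintSolution_dilate`, `isComplete_dilate` — dilation preserves the vacuum
  constraints and completeness;
* `InitialDataSet.dilateFamily C` — the family `l ↦ C.dilate l` (junk value `C` for `l ≤ 0`), and
  the joint smoothness of its two section maps on `{0 < l} × E3`
  (`contMDiffAt_dilateFamily_h`, `contMDiffAt_dilateFamily_k`), through
  `contMDiffAt_bilinE3_iff` (bundle smoothness over the model space `E3` is plain smoothness).

The asymptotically flat end of the dilated data is treated in `AFEndDilationDecay.lean`.
Everything is proved; no named facts.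

## References

* R. Bartnik, J. Isenberg, *The constraint equations* (2004), §2. [BartnikIsenberg2004]
* B. O'Neill, *Semi-Riemannian geometry* (1983), Ch. 3, Thm. 3.11, Prop. 3.59. [ONeill1983]
-/

noncomputable section

open Bundle Set Function Filter Manifold Bornology
open scoped Manifold ContDiff Topology

namespace Literature.Geometry.Lorentzian

/-! ### Completeness under homotheties -/

namespace InitialDataSet

section Homothety

variable {E : Type*} [NormedAddCommGroup E] [NormedSpace ℝ E] {H : Type*} [TopologicalSpace H]
  {I : ModelWithCorners ℝ E H} {X : Type*} [TopologicalSpace X] [ChartedSpace H X]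
  [IsManifold I ∞ X] [FiniteDimensional ℝ E] (D : InitialDataSet I X) {c : ℝ} (hc : 0 < c)
  [D.metric.HasLeviCivita] [(D.homothety c hc).metric.HasLeviCivita]

/-- **The Levi-Civita connection of the homothety `(c² h, c k)` is that of `h`** (the metric of the
homothety is `constSmul (c²) h`, `homothety_metric`, whose connection is unchanged,
`leviCivita_constSmul`). O'Neill 1983, Ch. 3, Thm. 3.11. [cite: ONeill1983, Ch. 3, Thm. 3.11] -/
theorem leviCivita_homothety : (D.homothety c hc).metric.leviCivita = D.metric.leviCivita := by
  have key : ∀ (g' : PseudoRiemannianMetric I ∞ E (TangentSpace I : X → Type _)) [g'.HasLeviCivita],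
      g' = D.metric.constSmul (c ^ 2) (pow_pos hc 2).ne' → g'.leviCivita = D.metric.leviCivita := by
    intro g' _ hg'
    subst hg'
    exact PseudoRiemannianMetric.leviCivita_constSmul (c ^ 2) (pow_pos hc 2).ne'
  exact key _ (D.homothety_metric hc)

/-- **Completeness is invariant under homotheties** (same Levi-Civita connection, hence the same
geodesics). O'Neill 1983, Ch. 3, Thm. 3.11. [cite: ONeill1983, Ch. 3, Thm. 3.11] -/
theorem isComplete_homothety_iff : (D.homothety c hc).IsComplete ↔ D.IsComplete := by
  unfold IsComplete
  rw [leviCivita_homothety]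

end Homothety

end InitialDataSet

/-! ### Bilinear-form sections over the model space `E3` -/

/-- **Over the model space `E3`, bundle smoothness of bilinear-form-valued maps is plain
smoothness**: `y ↦ (b y, s y) ∈ Hom(TE3, Hom(TE3, ℝ))` is `C^k` at `y₀` iff `b` and
`s : Y → (E3 →L E3 →L ℝ)` are (the tangent bundle of `E3` is trivialised by the identity,
`TangentBundle.symmL_model_space`). [folklore] -/
theorem contMDiffAt_bilinE3_iff {Y : Type*} [TopologicalSpace Y] {EY : Type*}
    [NormedAddCommGroup EY] [NormedSpace ℝ EY] {HY : Type*} [TopologicalSpace HY]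
    {IY : ModelWithCorners ℝ EY HY} [ChartedSpace HY Y] {k : ℕ∞ω} {b : Y → E3}
    {s : Π y, TangentSpace (𝓡 3) (b y) →L[ℝ] TangentSpace (𝓡 3) (b y) →L[ℝ] ℝ} {y₀ : Y} :
    ContMDiffAt IY ((𝓡 3).prod 𝓘(ℝ, E3 →L[ℝ] E3 →L[ℝ] ℝ)) k
      (fun y ↦ TotalSpace.mk' (E3 →L[ℝ] E3 →L[ℝ] ℝ)
        (E := fun x : E3 ↦ TangentSpace (𝓡 3) x →L[ℝ] TangentSpace (𝓡 3) x →L[ℝ] ℝ)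
        (b y) (s y)) y₀ ↔
      ContMDiffAt IY (𝓡 3) k b y₀ ∧
        ContMDiffAt IY 𝓘(ℝ, E3 →L[ℝ] E3 →L[ℝ] ℝ) k (fun y ↦ show E3 →L[ℝ] E3 →L[ℝ] ℝ from s y) y₀ := by
  rw [contMDiffAt_bilin_iff]
  refine and_congr_right fun _ ↦ ?_
  have h : (fun y ↦ (ContinuousLinearMap.precomp ℝ
      ((trivializationAt E3 (TangentSpace (𝓡 3) : E3 → Type _) (b y₀)).symmL ℝ (b y))).comp
        ((s y).comp ((trivializationAt E3 (TangentSpace (𝓡 3) : E3 → Type _) (b y₀)).symmL ℝ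
          (b y)))) = fun y ↦ show E3 →L[ℝ] E3 →L[ℝ] ℝ from s y := by
    funext y
    ext v w
    simp only [ContinuousLinearMap.coe_comp, comp_apply, ContinuousLinearMap.precomp_apply,
      TangentBundle.symmL_model_space]
    rfl
  rw [h]

namespace InitialDataSet

/-! ### The dilation map and the dilated data -/

/-- The contraction `y ↦ l⁻¹ y` of `E3` as a continuous linear map. [folklore] -/
def shrinkCLM (l : ℝ) : E3 →L[ℝ] E3 := l⁻¹ • ContinuousLinearMap.id ℝ E3

/-- `shrinkCLM l y = l⁻¹ y`. [folklore] -/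
@[simp]
theorem shrinkCLM_apply (l : ℝ) (y : E3) : shrinkCLM l y = l⁻¹ • y := rfl

/-- The contraction is smooth. [folklore] -/
theorem contMDiff_shrinkCLM (l : ℝ) : ContMDiff (𝓡 3) (𝓡 3) (∞ + 1) (shrinkCLM l) :=
  (shrinkCLM l).contDiff.contMDiff

/-- The differential of the contraction is the contraction. [folklore] -/
theorem mfderiv_shrinkCLM (l : ℝ) (y : E3) : mfderiv (𝓡 3) (𝓡 3) (shrinkCLM l) y = shrinkCLM l :=
  ContinuousLinearMap.mfderiv_eq _

/-- The differential of the contraction, applied: `dΔ_y v = l⁻¹ v`. [folklore] -/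
theorem mfderiv_shrinkCLM_apply (l : ℝ) (y v : E3) :
    mfderiv (𝓡 3) (𝓡 3) (shrinkCLM l) y v = l⁻¹ • v := by
  rw [mfderiv_shrinkCLM]; rfl

/-- The contraction as a continuous linear equivalence (inverse `y ↦ l y`), `l ≠ 0`. [folklore] -/
def shrinkCLE {l : ℝ} (hl : l ≠ 0) : E3 ≃L[ℝ] E3 :=
  ContinuousLinearEquiv.equivOfInverse (shrinkCLM l) (l • ContinuousLinearMap.id ℝ E3)
    (fun y ↦ show l • (l⁻¹ • y) = y by rw [smul_smul, mul_inv_cancel₀ hl, one_smul])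
    (fun y ↦ show l⁻¹ • (l • y) = y by rw [smul_smul, inv_mul_cancel₀ hl, one_smul])

/-- `shrinkCLE hl = shrinkCLM l` as functions. [folklore] -/
@[simp]
theorem coe_shrinkCLE {l : ℝ} (hl : l ≠ 0) : ⇑(shrinkCLE hl) = shrinkCLM l := rfl

/-- The differential of the contraction is injective for `l ≠ 0`. [folklore] -/
theorem injective_mfderiv_shrinkCLM {l : ℝ} (hl : l ≠ 0) (y : E3) :
    Injective (mfderiv (𝓡 3) (𝓡 3) (shrinkCLM l) y) := by
  rw [mfderiv_shrinkCLM]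
  exact (shrinkCLE hl).injective

variable (C : InitialDataSet (𝓡 3) E3) (l : ℝ) (hl : 0 < l)

/-- **The dilated data** `C.dilate l hl = (l² Δ^*h, l Δ^*k)`, `Δ(y) = y/l`: in components
`h'(y)(v, w) = h(y/l)(v, w)`, `k'(y)(v, w) = l⁻¹ k(y/l)(v, w)` — the homothety by `l` of the
pullback of `C` along the contraction. Bartnik–Isenberg 2004, §2 (diffeomorphism and scaling
covariance of the constraint map). [cite: BartnikIsenberg2004, §2] -/
def dilate : InitialDataSet (𝓡 3) E3 :=
  (C.comap (shrinkCLM l) (contMDiff_shrinkCLM l) (injective_mfderiv_shrinkCLM hl.ne')).homothety l hl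

/-- The metric of the dilated data: `h'(y)(v, w) = h(y/l)(v, w)`, in the coordinate reading
`coordH`. [cite: BartnikIsenberg2004, §2] -/
theorem coordH_dilate (y : E3) : (C.dilate l hl).coordH y = C.coordH (l⁻¹ • y) := by
  ext v w
  change l ^ 2 * C.h.inner (shrinkCLM l y) (mfderiv (𝓡 3) (𝓡 3) (shrinkCLM l) y v)
    (mfderiv (𝓡 3) (𝓡 3) (shrinkCLM l) y w) = _
  rw [mfderiv_shrinkCLM_apply, mfderiv_shrinkCLM_apply]
  change l ^ 2 * C.coordH (l⁻¹ • y) (l⁻¹ • v) (l⁻¹ • w) = C.coordH (l⁻¹ • y) v w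
  simp only [map_smul, FunLike.coe_smul, Pi.smul_apply, smul_eq_mul]
  field_simp [hl.ne']

/-- The tensor `k` of the dilated data: `k'(y)(v, w) = l⁻¹ k(y/l)(v, w)`, in the coordinate
reading `coordK`. [cite: BartnikIsenberg2004, §2] -/
theorem coordK_dilate (y : E3) : (C.dilate l hl).coordK y = l⁻¹ • C.coordK (l⁻¹ • y) := by
  ext v w
  change l * C.k (shrinkCLM l y) (mfderiv (𝓡 3) (𝓡 3) (shrinkCLM l) y v)
    (mfderiv (𝓡 3) (𝓡 3) (shrinkCLM l) y w) = _
  rw [mfderiv_shrinkCLM_apply, mfderiv_shrinkCLM_apply]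
  change l * C.coordK (l⁻¹ • y) (l⁻¹ • v) (l⁻¹ • w) = l⁻¹ * C.coordK (l⁻¹ • y) v w
  simp only [map_smul, FunLike.coe_smul, Pi.smul_apply, smul_eq_mul]
  field_simp [hl.ne']

/-- Pointwise form: `h'(y)(v, w) = h(y/l)(v, w)`. [cite: BartnikIsenberg2004, §2] -/
theorem dilate_h_inner (y v w : E3) :
    (C.dilate l hl).h.inner y v w = C.h.inner (l⁻¹ • y) v w := by
  have := C.coordH_dilate l hl y
  rw [← coordH_apply, this]; rfl

/-- Pointwise form: `k'(y)(v, w) = l⁻¹ k(y/l)(v, w)`. [cite: BartnikIsenberg2004, §2] -/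
theorem dilate_k (y v w : E3) :
    (C.dilate l hl).k y v w = l⁻¹ * C.k (l⁻¹ • y) v w := by
  have := C.coordK_dilate l hl y
  rw [← coordK_apply, this]; rfl

/-! ### Constraints and completeness -/

/-- **Dilation preserves the vacuum constraints** (diffeomorphism equivariance,
`isVacuumConstraintSolution_comap'`, and homothety invariance,
`IsVacuumConstraintSolution.homothety`). Bartnik–Isenberg 2004, §2. [cite: BartnikIsenberg2004, §2] -/
theorem isVacuumConstraintSolution_dilate [C.metric.HasLeviCivita]
    [(C.dilate l hl).metric.HasLeviCivita] (hC : C.IsVacuumConstraintSolution) :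
    (C.dilate l hl).IsVacuumConstraintSolution := by
  haveI := (C.comap (shrinkCLM l) (contMDiff_shrinkCLM l)
    (injective_mfderiv_shrinkCLM hl.ne')).metric.hasLeviCivita
  haveI : ((C.comap (shrinkCLM l) (contMDiff_shrinkCLM l)
      (injective_mfderiv_shrinkCLM hl.ne')).homothety l hl).metric.HasLeviCivita :=
    ‹(C.dilate l hl).metric.HasLeviCivita›
  exact IsVacuumConstraintSolution.homothety _ hl
    (C.isVacuumConstraintSolution_comap' (contMDiff_shrinkCLM l) (injective_mfderiv_shrinkCLM hl.ne') hC)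

/-- The contraction is an isometry from the pulled-back data to the data. [folklore] -/
theorem isIsometry_shrink :
    PseudoRiemannianMetric.IsIsometry
      (PseudoRiemannianMetric.ofRiemannian (C.comap (shrinkCLM l) (contMDiff_shrinkCLM l)
        (injective_mfderiv_shrinkCLM hl.ne')).h)
      (PseudoRiemannianMetric.ofRiemannian C.h) (shrinkCLE hl.ne').toDiffeomorph := by
  intro y
  rfl

/-- **Dilation preserves completeness** (isometry invariance of geodesic completeness,
`IsIsometry.isGeodesicallyComplete`, and `isComplete_homothety_iff`). O'Neill 1983, Ch. 3,
Prop. 3.59. [cite: ONeill1983, Ch. 3, Prop. 3.59] -/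
theorem isComplete_dilate [C.metric.HasLeviCivita] [(C.dilate l hl).metric.HasLeviCivita]
    (hC : C.IsComplete) : (C.dilate l hl).IsComplete := by
  haveI := (C.comap (shrinkCLM l) (contMDiff_shrinkCLM l)
    (injective_mfderiv_shrinkCLM hl.ne')).metric.hasLeviCivita
  haveI : ((C.comap (shrinkCLM l) (contMDiff_shrinkCLM l)
      (injective_mfderiv_shrinkCLM hl.ne')).homothety l hl).metric.HasLeviCivita :=
    ‹(C.dilate l hl).metric.HasLeviCivita›
  haveI : (PseudoRiemannianMetric.ofRiemannian (C.comap (shrinkCLM l) (contMDiff_shrinkCLM l)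
      (injective_mfderiv_shrinkCLM hl.ne')).h).HasLeviCivita := ‹_›
  haveI : (PseudoRiemannianMetric.ofRiemannian C.h).HasLeviCivita := ‹C.metric.HasLeviCivita›
  have key := isComplete_homothety_iff (C.comap (shrinkCLM l) (contMDiff_shrinkCLM l)
    (injective_mfderiv_shrinkCLM hl.ne')) hl
  exact key.2 ((isIsometry_shrink C l hl).isGeodesicallyComplete rfl hC)

/-! ### Smoothness of the dilation family in `(l, y)` -/

omit hl in
variable {l} in
/-- The metric of `C` is a smooth map `E3 → (E3 →L E3 →L ℝ)` in the coordinate reading `coordH`.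
[folklore] -/
theorem contMDiff_coordH : ContMDiff (𝓡 3) 𝓘(ℝ, E3 →L[ℝ] E3 →L[ℝ] ℝ) ∞ C.coordH :=
  fun y ↦ (contMDiffAt_bilinE3_iff.1 (C.h.contMDiff y)).2

omit hl in
variable {l} in
/-- The tensor `k` of `C` is a smooth map `E3 → (E3 →L E3 →L ℝ)` in the coordinate reading `coordK`.
[folklore] -/
theorem contMDiff_coordK : ContMDiff (𝓡 3) 𝓘(ℝ, E3 →L[ℝ] E3 →L[ℝ] ℝ) ∞ C.coordK :=
  fun y ↦ (contMDiffAt_bilinE3_iff.1 (C.contMDiff_k y)).2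

omit hl in
variable {l} in
/-- `(l, y) ↦ l⁻¹` is smooth on `{l ≠ 0}`. [folklore] -/
theorem contMDiffAt_inv_fst {p : ℝ × E3} (hp : p.1 ≠ 0) :
    ContMDiffAt (𝓘(ℝ, ℝ).prod (𝓡 3)) 𝓘(ℝ, ℝ) ∞ (fun q : ℝ × E3 ↦ q.1⁻¹) p :=
  (contDiffAt_inv ℝ hp).contMDiffAt.comp p contMDiffAt_fst

omit hl in
variable {l} in
/-- `(l, y) ↦ y/l` is smooth on `{l ≠ 0}`. [folklore] -/
theorem contMDiffAt_shrink_uncurry {p : ℝ × E3} (hp : p.1 ≠ 0) :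
    ContMDiffAt (𝓘(ℝ, ℝ).prod (𝓡 3)) (𝓡 3) ∞ (fun q : ℝ × E3 ↦ q.1⁻¹ • q.2) p :=
  (contMDiffAt_inv_fst hp).smul contMDiffAt_snd

open Classical in
/-- **The dilation family** `l ↦ C.dilate l` (junk value `C` for `l ≤ 0`, where the dilation is not
defined; only `l > 0` is ever used). [cite: BartnikIsenberg2004, §2] -/
def dilateFamily (l : ℝ) : InitialDataSet (𝓡 3) E3 :=
  if hl : 0 < l then C.dilate l hl else C

variable {l} in
/-- For `l > 0` the family is the dilated data. [folklore] -/
theorem dilateFamily_of_pos (hl : 0 < l) : C.dilateFamily l = C.dilate l hl := dif_pos hl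

/-- **Joint smoothness of the metric sections of the dilation family** on `{0 < l} × E3`
(`h_l(y) = h(y/l)` is the composite of the smooth `coordH` with the smooth `(l, y) ↦ y/l`).
[folklore] -/
theorem contMDiffAt_dilateFamily_h {p : ℝ × E3} (hp : 0 < p.1) :
    ContMDiffAt (𝓘(ℝ, ℝ).prod (𝓡 3)) ((𝓡 3).prod 𝓘(ℝ, E3 →L[ℝ] E3 →L[ℝ] ℝ)) ∞
      (fun q : ℝ × E3 ↦
        TotalSpace.mk' (E3 →L[ℝ] E3 →L[ℝ] ℝ)
          (E := fun x : E3 ↦ TangentSpace (𝓡 3) x →L[ℝ] TangentSpace (𝓡 3) x →L[ℝ] ℝ) q.2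
          ((C.dilateFamily q.1).h.inner q.2)) p := by
  have hev : ∀ᶠ q : ℝ × E3 in 𝓝 p, 0 < q.1 := (isOpen_lt continuous_const continuous_fst).mem_nhds hp
  have key : ContMDiffAt (𝓘(ℝ, ℝ).prod (𝓡 3)) ((𝓡 3).prod 𝓘(ℝ, E3 →L[ℝ] E3 →L[ℝ] ℝ)) ∞
      (fun q : ℝ × E3 ↦
        TotalSpace.mk' (E3 →L[ℝ] E3 →L[ℝ] ℝ)
          (E := fun x : E3 ↦ TangentSpace (𝓡 3) x →L[ℝ] TangentSpace (𝓡 3) x →L[ℝ] ℝ) q.2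
          (C.coordH (q.1⁻¹ • q.2))) p :=
    contMDiffAt_bilinE3_iff.2 ⟨contMDiffAt_snd,
      (C.contMDiff_coordH _).comp p (contMDiffAt_shrink_uncurry hp.ne')⟩
  refine key.congr_of_eventuallyEq ?_
  filter_upwards [hev] with q hq
  rw [C.dilateFamily_of_pos hq]
  exact congrArg _ (C.coordH_dilate q.1 hq q.2)

/-- **Joint smoothness of the `k` sections of the dilation family** on `{0 < l} × E3`
(`k_l(y) = l⁻¹ k(y/l)`). [folklore] -/
theorem contMDiffAt_dilateFamily_k {p : ℝ × E3} (hp : 0 < p.1) :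
    ContMDiffAt (𝓘(ℝ, ℝ).prod (𝓡 3)) ((𝓡 3).prod 𝓘(ℝ, E3 →L[ℝ] E3 →L[ℝ] ℝ)) ∞
      (fun q : ℝ × E3 ↦
        TotalSpace.mk' (E3 →L[ℝ] E3 →L[ℝ] ℝ)
          (E := fun x : E3 ↦ TangentSpace (𝓡 3) x →L[ℝ] TangentSpace (𝓡 3) x →L[ℝ] ℝ) q.2
          ((C.dilateFamily q.1).k q.2)) p := by
  have hev : ∀ᶠ q : ℝ × E3 in 𝓝 p, 0 < q.1 := (isOpen_lt continuous_const continuous_fst).mem_nhds hp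
  have key : ContMDiffAt (𝓘(ℝ, ℝ).prod (𝓡 3)) ((𝓡 3).prod 𝓘(ℝ, E3 →L[ℝ] E3 →L[ℝ] ℝ)) ∞
      (fun q : ℝ × E3 ↦
        TotalSpace.mk' (E3 →L[ℝ] E3 →L[ℝ] ℝ)
          (E := fun x : E3 ↦ TangentSpace (𝓡 3) x →L[ℝ] TangentSpace (𝓡 3) x →L[ℝ] ℝ) q.2
          (q.1⁻¹ • C.coordK (q.1⁻¹ • q.2))) p :=
    contMDiffAt_bilinE3_iff.2 ⟨contMDiffAt_snd,
      (contMDiffAt_inv_fst hp.ne').smul ((C.contMDiff_coordK _).comp p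
        (contMDiffAt_shrink_uncurry hp.ne'))⟩
  refine key.congr_of_eventuallyEq ?_
  filter_upwards [hev] with q hq
  rw [C.dilateFamily_of_pos hq]
  exact congrArg _ (C.coordK_dilate q.1 hq q.2)

end InitialDataSet

end Literature.Geometry.Lorentzian

end
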